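import Summits.Schanuel.Schanuel.Theorems.RootDecomp1KTwoBaseCell01

/-!
# RootDecomp1KTwoBaseCell — lens 1, generation 36 «TWO-BASE WALL CELL of 33364» (RootDecomp1KTwoBaseCell.lean f6aad3c3…, 1847 l) — continuation (RootDecomp1KTwoBaseCell02): §3 the LACUNARY NON-VANISHING LEMMA at the limit point `eventually_eval_partialSum_ne_zero` (any degree, general k)

(lens-1 g36 `RootDecomp1KTwoBaseCell.lean`, sha256 f6aad3c3…cd39, own farm rc 0 · 0 sorry · axioms std; critic VERDICT STATUS L1729 PORT GO LOW;
port by census-1 gen 15 in nine parts `RootDecomp1KTwoBaseCell01`–`09` — see the PORT NOTE of part 01; `--supports stmt-Schanuel-33364`; rung 0.)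
-/

noncomputable section

open Complex IntermediateField Polynomial
open Summit.Schanuel.Schanuel.Theorems.RootDecomp1KHyper
open Summit.Schanuel.Schanuel.Theorems.RootDecomp1KHyper.HyperCell
open Summit.Schanuel.Schanuel.Theorems.RootDecomp1KGeneric
open Summit.Schanuel.Schanuel.Theorems.RootDecomp1KRelLiouvilleCell
open Summit.Schanuel.Schanuel.Theorems.RootDecomp1KLogLogCell (LogLogLiouville logLogLiouville_of_logSqLiouville
  logLogLiouville_of_logHyperLiouville logLogLiouville_of_hyperLiouville)

namespace Summit.Schanuel.Schanuel.Theorems.RootDecomp1KTwoBaseCell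

open LiouvilleNumber
open scoped Nat

/-- The tail recursion `r_k = m^{-(k+1)!} + r_{k+1}`. -/
private theorem remainder_eq_succ {m : ℝ} (hm : 1 < m) (k : ℕ) :
    remainder m k = 1 / m ^ (k + 1)! + remainder m (k + 1) := by
  have h1 := partialSum_add_remainder hm k
  have h2 := partialSum_add_remainder hm (k + 1)
  rw [partialSum_succ] at h2
  linarith

/-- Lower bound for the tail: its first term, `m^{-(k+1)!} ≤ r_k`. -/
private theorem remainder_ge {m : ℝ} (hm : 1 < m) (k : ℕ) : 1 / m ^ (k + 1)! ≤ remainder m k := by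
  rw [remainder_eq_succ hm k]
  linarith [remainder_pos hm (k + 1)]

/-- Upper bound for the tail in base `m ≥ 2`: `r_k ≤ 2·m^{-(k+1)!}`. -/
private theorem remainder_le {m : ℝ} (hm : 2 ≤ m) (k : ℕ) : remainder m k ≤ 2 / m ^ (k + 1)! := by
  have m1 : (1 : ℝ) < m := by linarith
  have m0 : (0 : ℝ) < m := by linarith
  have h := remainder_lt' k m1
  have hhalf : (1 : ℝ) / m ≤ 1 / 2 := one_div_le_one_div_of_le two_pos hm
  have hpos : (0 : ℝ) < 1 - 1 / m := by linarith
  have hinv : (1 - 1 / m)⁻¹ ≤ 2 := by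
    rw [inv_le_comm₀ hpos two_pos]
    linarith
  have hmk : (0 : ℝ) < 1 / m ^ (k + 1)! := by positivity
  calc remainder m k ≤ (1 - 1 / m)⁻¹ * (1 / m ^ (k + 1)!) := h.le
    _ ≤ 2 * (1 / m ^ (k + 1)!) := mul_le_mul_of_nonneg_right hinv hmk.le
    _ = 2 / m ^ (k + 1)! := by ring

/-! ## §3  The lacunary non-vanishing lemma at the limit point -/

section Lacunary
open LiouvilleNumber
open scoped Nat

variable {k : ℕ}

/-- Degree of a monomial exponent, as a plain sum. -/
private theorem finsupp_sum_eq_sum (m : Fin k →₀ ℕ) : (m.sum fun _ e => e) = ∑ i, m i :=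
  Finsupp.sum_fintype _ _ fun _ => rfl

/-- `∏ (x_i)^{m_i}` is monotone in `0 ≤ x ≤ y`. -/
private theorem prod_pow_le_prod_pow {x y : Fin k → ℝ} (m : Fin k →₀ ℕ) (hx : ∀ i, 0 ≤ x i)
    (hxy : ∀ i, x i ≤ y i) : ∏ i, x i ^ m i ≤ ∏ i, y i ^ m i :=
  Finset.prod_le_prod (fun i _ => pow_nonneg (hx i) _) fun i _ => pow_le_pow_left₀ (hx i) (hxy i) _

/-- **THE LACUNARY NON-VANISHING LEMMA.** Bases `b_i ≥ 2` with injective monomial weights; then every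
non-zero real polynomial `q(Y_1,…,Y_k)` is non-zero at the truncation points `s_N = (partialSum b_i N)_i` for all
large `N`. (Proof: Taylor shift `p(W) = q(W + ℓ)`, `q(s_N) = p(-r_N)` with the tails
`b_i^{-M} ≤ r_{N,i} ≤ 2 b_i^{-M}`, `M = (N+1)!`; the support of `p` has a UNIQUE monomial `m₀` of least weight
`w₀ = ∏ b_i^{m₀,i}` and all other weights are `≥ w₀ + 1`, so the `m₀`-term `≥ |c₀| w₀^{-M}` beats the rest
`≤ B (w₀+1)^{-M}` as soon as `(1 + 1/w₀)^M > B/|c₀|`.) Effective: `N₀ = ⌈w₀ B/|c₀|⌉`. -/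
theorem eventually_eval_partialSum_ne_zero {b : Fin k → ℕ} (hb : ∀ i, 2 ≤ b i)
    (hinj : Function.Injective (wt b)) {q : MvPolynomial (Fin k) ℝ} (hq : q ≠ 0) :
    ∃ N₀ : ℕ, ∀ N, N₀ ≤ N → MvPolynomial.eval (fun i => partialSum (b i : ℝ) N) q ≠ 0 := by
  classical
  have hb1 : ∀ i, (1 : ℝ) < b i := fun i => by have := hb i; exact_mod_cast (by omega : 1 < b i)
  have hb2 : ∀ i, (2 : ℝ) ≤ b i := fun i => by exact_mod_cast hb i
  have hb0 : ∀ i, (0 : ℝ) < b i := fun i => by linarith [hb1 i]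
  set ℓ : Fin k → ℝ := fun i => liouvilleNumber (b i) with hℓ
  -- the Taylor shift `p(W) = q(W + ℓ)`
  set p : MvPolynomial (Fin k) ℝ :=
    MvPolynomial.bind₁ (fun i => MvPolynomial.X i + MvPolynomial.C (ℓ i)) q with hp
  have hpq : ∀ w : Fin k → ℝ,
      MvPolynomial.eval w p = MvPolynomial.eval (fun i => w i + ℓ i) q := by
    intro w
    have h1 : MvPolynomial.aeval w p = MvPolynomial.aeval (fun i => w i + ℓ i) q := by
      rw [hp, MvPolynomial.aeval_bind₁]
      have : (fun i => MvPolynomial.aeval w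
          ((MvPolynomial.X i : MvPolynomial (Fin k) ℝ) + MvPolynomial.C (ℓ i))) =
          fun i => w i + ℓ i := by
        funext i; simp
      rw [this]
    have e : ∀ (v : Fin k → ℝ) (f : MvPolynomial (Fin k) ℝ),
        MvPolynomial.aeval v f = MvPolynomial.eval v f := fun v f => rfl
    rw [← e, ← e]
    exact h1
  have hp0 : p ≠ 0 := by
    intro h0
    have hback : MvPolynomial.aeval (fun i => MvPolynomial.X i - MvPolynomial.C (ℓ i)) p = q := by
      rw [hp, MvPolynomial.aeval_bind₁]
      have : (fun i => MvPolynomial.aeval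
          (fun i => (MvPolynomial.X i : MvPolynomial (Fin k) ℝ) - MvPolynomial.C (ℓ i))
          (MvPolynomial.X i + MvPolynomial.C (ℓ i))) =
          (MvPolynomial.X : Fin k → MvPolynomial (Fin k) ℝ) := by
        funext i; simp
      rw [this, MvPolynomial.aeval_X_left_apply]
    rw [h0, map_zero] at hback
    exact hq hback.symm
  have hS : p.support.Nonempty := MvPolynomial.support_nonempty.mpr hp0
  obtain ⟨m₀, hm₀S, hmin⟩ := Finset.exists_min_image p.support (wt b) hS
  set w₀ : ℕ := wt b m₀ with hw₀def
  have hw₀ : 1 ≤ w₀ := one_le_wt hb m₀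
  have hw₀R : (1 : ℝ) ≤ w₀ := by exact_mod_cast hw₀
  have hw₀pos : (0 : ℝ) < w₀ := by linarith
  have hgap : ∀ m ∈ p.support, m ≠ m₀ → w₀ + 1 ≤ wt b m := by
    intro m hm hne
    have h1 : w₀ ≤ wt b m := hmin m hm
    have h2 : wt b m ≠ w₀ := fun h => hne (hinj h)
    omega
  set A : ℝ := |p.coeff m₀| with hAdef
  have hA : 0 < A := abs_pos.mpr (MvPolynomial.mem_support_iff.mp hm₀S)
  set B : ℝ := ∑ m ∈ p.support.erase m₀, |p.coeff m| * 2 ^ (∑ i, m i) with hBdef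
  have hB : 0 ≤ B := Finset.sum_nonneg fun m _ => by positivity
  refine ⟨⌈(w₀ : ℝ) * B / A⌉₊, fun N hN => ?_⟩
  set M : ℕ := (N + 1)! with hMdef
  have hNM : N + 1 ≤ M := Nat.self_le_factorial _
  have hM : (w₀ : ℝ) * B / A < M := by
    have h1 : (w₀ : ℝ) * B / A ≤ ⌈(w₀ : ℝ) * B / A⌉₊ := Nat.le_ceil _
    have h2 : (⌈(w₀ : ℝ) * B / A⌉₊ : ℝ) ≤ N := by exact_mod_cast hN
    have h3 : (N : ℝ) + 1 ≤ M := by exact_mod_cast hNM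
    linarith
  -- the tails
  set r : Fin k → ℝ := fun i => remainder (b i) N with hr
  have hr_pos : ∀ i, 0 < r i := fun i => remainder_pos (hb1 i) N
  have hr_lo : ∀ i, 1 / (b i : ℝ) ^ M ≤ r i := fun i => remainder_ge (hb1 i) N
  have hr_hi : ∀ i, r i ≤ 2 / (b i : ℝ) ^ M := fun i => remainder_le (hb2 i) N
  have hs : (fun i => partialSum (b i : ℝ) N) = fun i => -r i + ℓ i := by
    funext i
    have := partialSum_add_remainder (hb1 i) N
    simp only [hr, hℓ]
    linarith
  rw [show MvPolynomial.eval (fun i => partialSum (b i : ℝ) N) q =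
      MvPolynomial.eval (fun i => -r i) p by rw [hpq, hs]]
  rw [MvPolynomial.eval_eq', ← Finset.add_sum_erase _ _ hm₀S]
  -- the main term
  have hmain : A / (w₀ : ℝ) ^ M ≤ |p.coeff m₀ * ∏ i, (-r i) ^ m₀ i| := by
    rw [abs_mul, ← hAdef, Finset.abs_prod]
    have e1 : ∀ i, |(-r i) ^ m₀ i| = r i ^ m₀ i := fun i => by
      rw [abs_pow, abs_neg, abs_of_pos (hr_pos i)]
    simp only [e1]
    have hlow : ∏ i, (1 / (b i : ℝ) ^ M) ^ m₀ i ≤ ∏ i, r i ^ m₀ i :=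
      prod_pow_le_prod_pow m₀ (fun i => by positivity) hr_lo
    have e2 : ∏ i, (1 / (b i : ℝ) ^ M) ^ m₀ i = 1 / (w₀ : ℝ) ^ M := by
      rw [wt_cast, ← Finset.prod_pow, one_div (∏ x, ((b x : ℝ) ^ m₀ x) ^ M),
        ← Finset.prod_inv_distrib]
      exact Finset.prod_congr rfl fun i _ => by rw [one_div, inv_pow, ← pow_mul, ← pow_mul, mul_comm]
    rw [div_eq_mul_one_div]
    rw [e2] at hlow
    exact mul_le_mul_of_nonneg_left hlow hA.le
  -- the other terms
  have hrest : |∑ m ∈ p.support.erase m₀, p.coeff m * ∏ i, (-r i) ^ m i| ≤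
      B / ((w₀ : ℝ) + 1) ^ M := by
    refine (Finset.abs_sum_le_sum_abs _ _).trans ?_
    rw [hBdef, Finset.sum_div]
    refine Finset.sum_le_sum fun m hm => ?_
    have hmS : m ∈ p.support := Finset.mem_of_mem_erase hm
    have hne : m ≠ m₀ := Finset.ne_of_mem_erase hm
    rw [abs_mul, Finset.abs_prod]
    have e1 : ∀ i, |(-r i) ^ m i| = r i ^ m i := fun i => by
      rw [abs_pow, abs_neg, abs_of_pos (hr_pos i)]
    simp only [e1]
    have hup : ∏ i, r i ^ m i ≤ ∏ i, (2 / (b i : ℝ) ^ M) ^ m i :=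
      prod_pow_le_prod_pow m (fun i => (hr_pos i).le) hr_hi
    have e2 : ∏ i, (2 / (b i : ℝ) ^ M) ^ m i = 2 ^ (∑ i, m i) / (wt b m : ℝ) ^ M := by
      rw [wt_cast, ← Finset.prod_pow, ← Finset.prod_pow_eq_pow_sum, ← Finset.prod_div_distrib]
      exact Finset.prod_congr rfl fun i _ => by rw [div_pow, ← pow_mul, ← pow_mul, mul_comm]
    have hwt : ((w₀ : ℝ) + 1) ^ M ≤ (wt b m : ℝ) ^ M := by
      have : (w₀ : ℝ) + 1 ≤ wt b m := by exact_mod_cast hgap m hmS hne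
      exact pow_le_pow_left₀ (by positivity) this M
    calc |p.coeff m| * ∏ i, r i ^ m i ≤ |p.coeff m| * (2 ^ (∑ i, m i) / (wt b m : ℝ) ^ M) := by
          rw [← e2]; exact mul_le_mul_of_nonneg_left hup (abs_nonneg _)
      _ ≤ |p.coeff m| * (2 ^ (∑ i, m i) / ((w₀ : ℝ) + 1) ^ M) := by
          refine mul_le_mul_of_nonneg_left ?_ (abs_nonneg _)
          exact div_le_div_of_nonneg_left (by positivity) (by positivity) hwt
      _ = |p.coeff m| * 2 ^ (∑ i, m i) / ((w₀ : ℝ) + 1) ^ M := by ring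
  -- domination: A (w₀+1)^M > B w₀^M
  have hdom : B / ((w₀ : ℝ) + 1) ^ M < A / (w₀ : ℝ) ^ M := by
    have hbern : 1 + (M : ℝ) * (1 / w₀) ≤ (1 + 1 / (w₀ : ℝ)) ^ M :=
      one_add_mul_le_pow (by linarith [show (0 : ℝ) ≤ 1 / (w₀ : ℝ) from by positivity]) M
    have hratio : B / A < (1 + 1 / (w₀ : ℝ)) ^ M := by
      have h1 : B / A < 1 + (M : ℝ) * (1 / w₀) := by
        rw [div_lt_iff₀ hA]
        have : (w₀ : ℝ) * B < M * A := by
          have := hM; rwa [div_lt_iff₀ hA] at this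
        have h2 : B < (M : ℝ) * (1 / w₀) * A := by
          rw [show (M : ℝ) * (1 / w₀) * A = M * A / w₀ by ring, lt_div_iff₀ hw₀pos]
          linarith
        linarith
      linarith
    have e : (1 + 1 / (w₀ : ℝ)) ^ M = ((w₀ : ℝ) + 1) ^ M / (w₀ : ℝ) ^ M := by
      rw [← div_pow]; congr 1; field_simp
    rw [e, lt_div_iff₀ (by positivity)] at hratio
    rw [div_lt_div_iff₀ (by positivity) (by positivity)]
    calc B * (w₀ : ℝ) ^ M = B / A * (w₀ : ℝ) ^ M * A := by field_simp
      _ < ((w₀ : ℝ) + 1) ^ M * A := by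
          have := mul_lt_mul_of_pos_right hratio hA
          linarith
      _ = A * ((w₀ : ℝ) + 1) ^ M := by ring
  -- conclude
  intro hzero
  have habs : |p.coeff m₀ * ∏ i, (-r i) ^ m₀ i| =
      |∑ m ∈ p.support.erase m₀, p.coeff m * ∏ i, (-r i) ^ m i| := by
    have : p.coeff m₀ * ∏ i, (-r i) ^ m₀ i =
        -(∑ m ∈ p.support.erase m₀, p.coeff m * ∏ i, (-r i) ^ m i) := by linarith
    rw [this, abs_neg]
  linarith [hmain, hrest, hdom, habs]

end Lacunary

end Summit.Schanuel.Schanuel.Theorems.RootDecomp1KTwoBaseCell
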